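import Literature.Computation.Certificates.SumOfSquares
import Mathlib.Data.Nat.Choose.Sum
import Mathlib.Algebra.Order.Field.Basic
import Mathlib.Algebra.Order.BigOperators.Group.Finset
import Mathlib.Algebra.BigOperators.Field
import Mathlib.Tactic.FieldSimp
import Mathlib.Tactic.Positivity
import Mathlib.Tactic.Ring
import HarnessLib

/-!
# GridStability/Lyapunov/PolyRecastBernstein — a `decide`-able TENSOR-BERNSTEIN range enclosure of an emitted `Poly` on a
# rational box: `min b ≤ p(x) ≤ max b` when `lo_i ≤ x_i ≤ hi_i`

Cell `gridfusion` (LADDER-GRIDFUSION), `plan/PARTITION.md` §0 row `Lyapunov/` (generic glue in the namespace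
`Summit.Ventures.GridStability.Lyapunov.PolyRecast`, sibling of `PolyRecastBox.lean` p536818); seat gridfusion-lyap-2 (g6),
lever L2 «BERNSTEIN ENCLOSURE» of HOME/lean/lyap-2/g5/LEVER-NOTE.md. PURPOSE: the REGION-SIZE riders («… BALL», «BALL+», «BALL-M»)
and every other «explicit box ⊆ certified sublevel piece» / box-positivity step in the cell bound a fixed rational polynomial `V`
(tens to hundreds of monomials) over a box with rational corners. The coefficient majorant `absBox` of `PolyRecastBox.lean`
(and Moore's natural interval extension, `Literature/Computation/Certificates/PolyIntervalEnclosure.lean`) ignores sign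
cancellation between monomials; the TENSOR-PRODUCT BERNSTEIN FORM does not: writing
`p(x) = Σ_J b_J Π_i B_{d_i,J_i}((x_i − lo_i)/(hi_i − lo_i))` with `B_{d,j}(t) = C(d,j) t^j (1 − t)^{d−j}`, the weights are
nonnegative on the box and sum to one, so `min_J b_J ≤ p(x) ≤ max_J b_J` there (Cargo–Shisha 1966 in one variable; Garloff 1986 §2;
the enclosure converges under subdivision of the box, which here is free: every sub-box carries its own coefficient list).

The ABSTRACT enclosure is already in the tree (`Literature/Computation/Certificates/TensorBernsteinEnclosure.lean`:
`TensorBernstein.weight_nonneg / sum_weight_eq_one / form_le_of_forall_le`, on `unitInterval`-valued points of a `Fintype` box, the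
representation entering as a hypothesis; `Literature/Analysis/ValidatedNumerics/BernsteinRangeEnclosure.lean`: one and two
variables, identity instances checked by `ring`). What was missing is the KERNEL READER for the `SOS.Poly` vocabulary of the
cell's certificates (`Literature/Computation/Certificates/SumOfSquares.lean`: `Poly = List (Monomial × ℚ)`, `Poly.eval`,
computable `add / mul / smul / neg / norm / isZero`), i.e. a structurally recursive Bernstein form whose identity with `p` is ONE
`decide`, exactly like `absBox`. This file supplies it; nothing of any certificate is restated.

* `bernC`, `bernPow`, `bernSum` — constant (`[]` for `0`), power and finite sum of `Poly`s (computable, with `eval` lemmas);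
* `bern1 i d j lo hi` — the scaled Bernstein basis element `C(d,j) (x_i − lo)^j (hi − x_i)^{d−j} / (hi − lo)^d` as a `Poly` in the
  variable `x_i`; `eval_bern1`, `eval_bern1_nonneg` (on `lo ≤ x_i ≤ hi`), `sum_eval_bern1` (`Σ_{j ≤ d} = 1` when `lo < hi`, by the
  binomial theorem `add_pow` — no Mathlib Bernstein import is needed);
* `bernGrid d = Π_i (d_i + 1)` and `bernForm lo hi k d b` — the NESTED tensor form
  `Σ_{j ≤ d_k} bern1 k d_k j · (form of the remaining variables with the j-th coefficient block)`, the coefficients `b : List ℚ` read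
  in lexicographic order of the multi-index (first variable slowest; block `j` of variable `k` starts at offset `j · bernGrid ds`);
* `eval_bernForm_le` / `le_eval_bernForm` — THE ENCLOSURE: all listed coefficients `≤ M` (`≥ m`) ⇒ `form(x) ≤ M` (`≥ m`) on the box;
* `bernWidths`, `bernRep p d lo hi b` — the decidable REPRESENTATION CHECK `lo_k < hi_k (k < |d|) ∧ bernGrid d ≤ |b| ∧
  isZero (norm p − bernForm)`; `eval_eq_bernForm_of_bernRep`, `eval_le_of_bernRep`, `le_eval_of_bernRep`;
* `bernUpper p d lo hi b M` / `bernLower p d lo hi b m` — representation check AND coefficient test in one `Bool` (the shape a rider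
  decides), `eval_le_of_bernUpper` / `le_eval_of_bernLower`: for every `x : ℕ → K` (`K` a linear ordered field) with
  `lo_i ≤ x_i ≤ hi_i` for `i < |d|`, `p.eval x ≤ M` (resp. `m ≤ p.eval x`).

The coefficient list is DATA supplied by the caller (a generator converts power basis → Bernstein basis exactly over `ℚ`); the kernel
never trusts it: `bernRep` re-expands the form and compares with `p` term by term. Cost: the nested expansion is
`O(n · Π(d_i + 1) · (max d_i + 1))` term operations (a 3-variable sextic: a few thousand), far below one Gram-matrix check.
Pure bookkeeping (MODELLED/CERTIFIED columns untouched): standard axioms, no named fact; the `def`s are computation-oriented data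
refinements of the printed tensor Bernstein form. References: J. Garloff, *Convergent bounds for the range of multivariate
polynomials*, Interval Mathematics 1985, LNCS 212 (1986) 37–56, §2 [cite: Garloff1986, §2]; G. T. Cargo, O. Shisha, *The Bernstein
form of a polynomial*, J. Res. NBS 70B (1966) 79–81 [cite: CargoShisha1966, Thm 1].
-/

open Finset
open Literature.Computation.Certificates Literature.Computation.Certificates.SOS

namespace Summit.Ventures.GridStability.Lyapunov.PolyRecast

/-! ### Computable building blocks -/

/-- Constant polynomial, with the empty term list for `0` (keeps the expanded forms free of zero terms). [folklore] -/
def bernC (c : ℚ) : Poly := if c = 0 then [] else Poly.C c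

/-- Power of a sparse polynomial (repeated `Poly.mul`). [folklore] -/
def bernPow (p : Poly) : ℕ → Poly
  | 0 => Poly.C 1
  | n + 1 => Poly.mul p (bernPow p n)

/-- Finite sum `Σ_{j < n} f j` of sparse polynomials (repeated `Poly.add`). [folklore] -/
def bernSum (f : ℕ → Poly) : ℕ → Poly
  | 0 => []
  | n + 1 => Poly.add (f n) (bernSum f n)

/-- The scaled Bernstein basis element of degree `d`, index `j`, on the interval `[lo, hi]`, in the variable `x_i`, as a sparse
polynomial: `bern1 i d j lo hi = C(d,j) · (x_i − lo)^j · (hi − x_i)^{d−j} / (hi − lo)^d`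
(`= B_{d,j}((x_i − lo)/(hi − lo))`). [cite: Garloff1986, §2] -/
def bern1 (i d j : ℕ) (lo hi : ℚ) : Poly :=
  Poly.smul ((d.choose j : ℚ) / (hi - lo) ^ d)
    (Poly.mul (bernPow (Poly.add (Poly.X i) (bernC (-lo))) j)
      (bernPow (Poly.add (bernC hi) (Poly.neg (Poly.X i))) (d - j)))

/-- Number of tensor Bernstein coefficients for the degree vector `d`: `bernGrid d = Π_i (d_i + 1)`. [cite: Garloff1986, §2] -/
def bernGrid : List ℕ → ℕ
  | [] => 1
  | d :: ds => (d + 1) * bernGrid ds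

/-- The NESTED tensor Bernstein form with coefficient list `b` (lexicographic, first variable slowest), degrees `ds` for the
variables `x_k, x_{k+1}, …` and box `[lo_k, hi_k] × [lo_{k+1}, hi_{k+1}] × ⋯`:
`bernForm lo hi k (d :: ds) b = Σ_{j ≤ d} bern1 k d j (lo k) (hi k) · bernForm lo hi (k+1) ds (b.drop (j · bernGrid ds))` and
`bernForm lo hi k [] b = b₀` (coefficients past the end of `b` read as `0`). [cite: Garloff1986, §2] -/
def bernForm (lo hi : ℕ → ℚ) : ℕ → List ℕ → List ℚ → Poly
  | _, [], b => bernC (b.getD 0 0)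
  | k, d :: ds, b =>
      bernSum (fun j => Poly.mul (bern1 k d j (lo k) (hi k)) (bernForm lo hi (k + 1) ds (b.drop (j * bernGrid ds)))) (d + 1)

/-- Positivity of the box widths for the variables `x_k, …, x_{k+n−1}`: `lo_i < hi_i`. [folklore] -/
def bernWidths (lo hi : ℕ → ℚ) : ℕ → ℕ → Bool
  | _, 0 => true
  | k, n + 1 => decide (lo k < hi k) && bernWidths lo hi (k + 1) n

/-- **Representation check** (the part the kernel never trusts): the widths are positive, the coefficient list covers the whole
grid, and `p` IS the tensor Bernstein form with coefficients `b` — `isZero (norm p − bernForm lo hi 0 d b)`, an exact identity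
of sparse rational polynomials whatever the term order of `p`. [cite: Garloff1986, §2] -/
def bernRep (p : Poly) (d : List ℕ) (lo hi : ℕ → ℚ) (b : List ℚ) : Bool :=
  bernWidths lo hi 0 d.length && decide (bernGrid d ≤ b.length) &&
    Poly.isZero (Poly.add (Poly.norm p) (Poly.neg (bernForm lo hi 0 d b)))

/-- **Upper range test**: representation check and «every Bernstein coefficient `≤ M`». [cite: Garloff1986, §2] -/
def bernUpper (p : Poly) (d : List ℕ) (lo hi : ℕ → ℚ) (b : List ℚ) (M : ℚ) : Bool :=
  bernRep p d lo hi b && b.all fun c => decide (c ≤ M)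

/-- **Lower range test**: representation check and «every Bernstein coefficient `≥ m`». [cite: Garloff1986, §2] -/
def bernLower (p : Poly) (d : List ℕ) (lo hi : ℕ → ℚ) (b : List ℚ) (m : ℚ) : Bool :=
  bernRep p d lo hi b && b.all fun c => decide (m ≤ c)

/-! ### Evaluation lemmas -/

section Eval

variable {K : Type*} [Field K] [LinearOrder K] [IsStrictOrderedRing K]

omit [LinearOrder K] [IsStrictOrderedRing K] in
/-- `eval` of `bernC`. [folklore] -/
theorem eval_bernC (x : ℕ → K) (c : ℚ) : Poly.eval x (bernC c) = (c : K) := by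
  unfold bernC
  split_ifs with h
  · simp [h]
  · exact Poly.eval_C x c

/-- `eval` of `bernPow` is the power of `eval`. [folklore] -/
theorem eval_bernPow (x : ℕ → K) (p : Poly) : ∀ n : ℕ, Poly.eval x (bernPow p n) = (Poly.eval x p) ^ n
  | 0 => by simp [bernPow]
  | n + 1 => by rw [bernPow, Poly.eval_mul, eval_bernPow x p n, pow_succ']

/-- `eval` of `bernSum` is the `Finset.range` sum of the `eval`s. [folklore] -/
theorem eval_bernSum (x : ℕ → K) (f : ℕ → Poly) :
    ∀ n : ℕ, Poly.eval x (bernSum f n) = ∑ j ∈ range n, Poly.eval x (f j)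
  | 0 => by simp [bernSum]
  | n + 1 => by rw [bernSum, Poly.eval_add, eval_bernSum x f n, sum_range_succ, add_comm]

/-- `eval` of the scaled Bernstein basis element: `C(d,j)/(hi − lo)^d · (x_i − lo)^j (hi − x_i)^{d−j}`. [cite: Garloff1986, §2] -/
theorem eval_bern1 (x : ℕ → K) (i d j : ℕ) (lo hi : ℚ) :
    Poly.eval x (bern1 i d j lo hi) =
      (((d.choose j : ℚ) / (hi - lo) ^ d : ℚ) : K) * ((x i - (lo : K)) ^ j * ((hi : K) - x i) ^ (d - j)) := by
  simp only [bern1, Poly.eval_smul, Poly.eval_mul, eval_bernPow, Poly.eval_add, Poly.eval_X, eval_bernC,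
    Poly.eval_neg, Rat.cast_neg]
  ring

/-- The basis elements are NONNEGATIVE on the interval: `lo ≤ x_i ≤ hi`, `lo < hi` ⇒ `0 ≤ bern1 i d j lo hi (x)`.
[cite: Garloff1986, §2] -/
theorem eval_bern1_nonneg {x : ℕ → K} {i : ℕ} {lo hi : ℚ} (hlo : (lo : K) ≤ x i) (hhi : x i ≤ (hi : K))
    (hw : lo < hi) (d j : ℕ) : 0 ≤ Poly.eval x (bern1 i d j lo hi) := by
  rw [eval_bern1]
  have h1 : (0 : K) ≤ x i - lo := sub_nonneg.2 hlo
  have h2 : (0 : K) ≤ hi - x i := sub_nonneg.2 hhi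
  have h3 : (0 : ℚ) ≤ (d.choose j : ℚ) / (hi - lo) ^ d :=
    div_nonneg (Nat.cast_nonneg _) (pow_nonneg (sub_pos.2 hw).le d)
  have h3' : (0 : K) ≤ (((d.choose j : ℚ) / (hi - lo) ^ d : ℚ) : K) := by exact_mod_cast h3
  exact mul_nonneg h3' (mul_nonneg (pow_nonneg h1 j) (pow_nonneg h2 (d - j)))

/-- The basis elements of degree `d` SUM TO ONE (partition of unity, binomial theorem): `lo < hi` ⇒
`Σ_{j ≤ d} bern1 i d j lo hi (x) = 1` at every point. [cite: Garloff1986, §2] -/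
theorem sum_eval_bern1 (x : ℕ → K) (i d : ℕ) {lo hi : ℚ} (hw : lo < hi) :
    ∑ j ∈ range (d + 1), Poly.eval x (bern1 i d j lo hi) = 1 := by
  have hK : (lo : K) < hi := by exact_mod_cast hw
  have hw' : ((hi : K) - lo) ≠ 0 := sub_ne_zero.2 (ne_of_gt hK)
  have key : ∑ j ∈ range (d + 1), (x i - (lo : K)) ^ j * ((hi : K) - x i) ^ (d - j) * (d.choose j : K) =
      ((hi : K) - lo) ^ d := by
    rw [← add_pow]; congr 1; ring
  have step : ∀ j ∈ range (d + 1), Poly.eval x (bern1 i d j lo hi) =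
      ((x i - (lo : K)) ^ j * ((hi : K) - x i) ^ (d - j) * (d.choose j : K)) / ((hi : K) - lo) ^ d := by
    intro j _
    rw [eval_bern1]
    push_cast
    ring
  rw [sum_congr rfl step, ← sum_div, key, div_self (pow_ne_zero d hw')]

/-- `bernGrid` is positive. [folklore] -/
theorem bernGrid_pos : ∀ ds : List ℕ, 0 < bernGrid ds
  | [] => Nat.one_pos
  | d :: ds => Nat.mul_pos (Nat.succ_pos d) (bernGrid_pos ds)

/-- Reading a dropped list: `(b.drop n).getD i 0 = b.getD (n + i) 0`. [folklore] -/
theorem getD_drop (b : List ℚ) (n i : ℕ) : (b.drop n).getD i 0 = b.getD (n + i) 0 := by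
  rw [List.getD_eq_getElem?_getD, List.getD_eq_getElem?_getD, List.getElem?_drop]

/-- Block offsets stay inside the grid: `j ≤ d`, `i < S` ⇒ `j · S + i < (d + 1) · S`. [folklore] -/
theorem blockIndex_lt {j d i S : ℕ} (hj : j < d + 1) (hi : i < S) : j * S + i < (d + 1) * S := by
  have h1 : j * S + i < (j + 1) * S := by rw [Nat.succ_mul]; exact Nat.add_lt_add_left hi _
  exact lt_of_lt_of_le h1 (Nat.mul_le_mul_right _ hj)

/-- **THE ENCLOSURE FROM ABOVE** (semantic form). If the widths of the variables `x_k, …` are positive, the point lies in the box,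
and every coefficient read by the form is `≤ M`, then `bernForm lo hi k ds b (x) ≤ M` — by induction on the variables: the value
is a convex combination (weights `bern1 k d j`, nonnegative, summing to one) of the values of the sub-forms. [cite: Garloff1986, §2] -/
theorem eval_bernForm_le {x : ℕ → K} {lo hi : ℕ → ℚ} {M : ℚ} :
    ∀ (ds : List ℕ) (k : ℕ) (b : List ℚ),
      (∀ i, i < ds.length → lo (k + i) < hi (k + i)) →
      (∀ i, i < ds.length → (lo (k + i) : K) ≤ x (k + i) ∧ x (k + i) ≤ (hi (k + i) : K)) →
      (∀ i, i < bernGrid ds → b.getD i 0 ≤ M) →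
      Poly.eval x (bernForm lo hi k ds b) ≤ (M : K)
  | [], k, b, _, _, hb => by
      rw [bernForm, eval_bernC]
      exact_mod_cast hb 0 (bernGrid_pos [])
  | d :: ds, k, b, hw, hx, hb => by
      rw [bernForm, eval_bernSum]
      have hw0 : lo k < hi k := by simpa using hw 0 (by simp)
      have hx0 : (lo k : K) ≤ x k ∧ x k ≤ (hi k : K) := by simpa using hx 0 (by simp)
      have hchild : ∀ j ∈ range (d + 1),
          Poly.eval x (bernForm lo hi (k + 1) ds (b.drop (j * bernGrid ds))) ≤ (M : K) := by
        intro j hj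
        refine eval_bernForm_le ds (k + 1) _ ?_ ?_ ?_
        · intro i hi
          have h := hw (i + 1) (by simpa using hi)
          rwa [show k + (i + 1) = k + 1 + i by omega] at h
        · intro i hi
          have h := hx (i + 1) (by simpa using hi)
          rwa [show k + (i + 1) = k + 1 + i by omega] at h
        · intro i hi
          rw [getD_drop]
          exact hb _ (blockIndex_lt (mem_range.1 hj) hi)
      calc ∑ j ∈ range (d + 1), Poly.eval x (Poly.mul (bern1 k d j (lo k) (hi k))
              (bernForm lo hi (k + 1) ds (b.drop (j * bernGrid ds))))
          ≤ ∑ j ∈ range (d + 1), Poly.eval x (bern1 k d j (lo k) (hi k)) * (M : K) := by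
            refine sum_le_sum fun j hj => ?_
            rw [Poly.eval_mul]
            exact mul_le_mul_of_nonneg_left (hchild j hj) (eval_bern1_nonneg hx0.1 hx0.2 hw0 d j)
        _ = (M : K) := by rw [← sum_mul, sum_eval_bern1 x k d hw0, one_mul]

/-- **THE ENCLOSURE FROM BELOW** (semantic form): every coefficient read by the form `≥ m` ⇒ `m ≤ bernForm lo hi k ds b (x)` on
the box. [cite: Garloff1986, §2] -/
theorem le_eval_bernForm {x : ℕ → K} {lo hi : ℕ → ℚ} {m : ℚ} :
    ∀ (ds : List ℕ) (k : ℕ) (b : List ℚ),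
      (∀ i, i < ds.length → lo (k + i) < hi (k + i)) →
      (∀ i, i < ds.length → (lo (k + i) : K) ≤ x (k + i) ∧ x (k + i) ≤ (hi (k + i) : K)) →
      (∀ i, i < bernGrid ds → m ≤ b.getD i 0) →
      (m : K) ≤ Poly.eval x (bernForm lo hi k ds b)
  | [], k, b, _, _, hb => by
      rw [bernForm, eval_bernC]
      exact_mod_cast hb 0 (bernGrid_pos [])
  | d :: ds, k, b, hw, hx, hb => by
      rw [bernForm, eval_bernSum]
      have hw0 : lo k < hi k := by simpa using hw 0 (by simp)
      have hx0 : (lo k : K) ≤ x k ∧ x k ≤ (hi k : K) := by simpa using hx 0 (by simp)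
      have hchild : ∀ j ∈ range (d + 1),
          (m : K) ≤ Poly.eval x (bernForm lo hi (k + 1) ds (b.drop (j * bernGrid ds))) := by
        intro j hj
        refine le_eval_bernForm ds (k + 1) _ ?_ ?_ ?_
        · intro i hi
          have h := hw (i + 1) (by simpa using hi)
          rwa [show k + (i + 1) = k + 1 + i by omega] at h
        · intro i hi
          have h := hx (i + 1) (by simpa using hi)
          rwa [show k + (i + 1) = k + 1 + i by omega] at h
        · intro i hi
          rw [getD_drop]
          exact hb _ (blockIndex_lt (mem_range.1 hj) hi)
      calc (m : K) = ∑ j ∈ range (d + 1), Poly.eval x (bern1 k d j (lo k) (hi k)) * (m : K) := by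
            rw [← sum_mul, sum_eval_bern1 x k d hw0, one_mul]
        _ ≤ ∑ j ∈ range (d + 1), Poly.eval x (Poly.mul (bern1 k d j (lo k) (hi k))
              (bernForm lo hi (k + 1) ds (b.drop (j * bernGrid ds)))) := by
            refine sum_le_sum fun j hj => ?_
            rw [Poly.eval_mul]
            exact mul_le_mul_of_nonneg_left (hchild j hj) (eval_bern1_nonneg hx0.1 hx0.2 hw0 d j)

/-! ### The decidable checks and their soundness -/

/-- Soundness of `bernWidths`: every checked width is positive. [folklore] -/
theorem bernWidths_sound {lo hi : ℕ → ℚ} :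
    ∀ (n k : ℕ), bernWidths lo hi k n = true → ∀ i, i < n → lo (k + i) < hi (k + i)
  | 0, _, _, _, hi => absurd hi (Nat.not_lt_zero _)
  | n + 1, k, h, i, hi => by
      rw [bernWidths, Bool.and_eq_true, decide_eq_true_eq] at h
      rcases i with _ | i
      · simpa using h.1
      · have h' := bernWidths_sound n (k + 1) h.2 i (by omega)
        rwa [show k + 1 + i = k + (i + 1) by omega] at h'

/-- A list entry below a covered length is a member: `i < |b|` ⇒ `b.getD i 0 ∈ b`. [folklore] -/
theorem getD_mem {b : List ℚ} {i : ℕ} (hi : i < b.length) : b.getD i 0 ∈ b := by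
  rw [List.getD_eq_getElem?_getD, List.getElem?_eq_getElem hi, Option.getD_some]
  exact List.getElem_mem hi

/-- **The representation check identifies `p` with the form**: `bernRep p d lo hi b` ⇒ `p(x) = bernForm lo hi 0 d b (x)` at every
point (any field of characteristic zero). [cite: Garloff1986, §2] -/
theorem eval_eq_bernForm_of_bernRep {p : Poly} {d : List ℕ} {lo hi : ℕ → ℚ} {b : List ℚ}
    (h : bernRep p d lo hi b = true) (x : ℕ → K) :
    Poly.eval x p = Poly.eval x (bernForm lo hi 0 d b) := by
  simp only [bernRep, Bool.and_eq_true] at h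
  have hz := Poly.eval_eq_zero_of_isZero x h.2
  rw [Poly.eval_add, Poly.eval_norm, Poly.eval_neg] at hz
  exact sub_eq_zero.1 (by rw [sub_eq_add_neg]; exact hz)

/-- **Range enclosure from above, by a checked representation**: `bernRep p d lo hi b`, every listed coefficient `≤ M`, and
`lo_i ≤ x_i ≤ hi_i` for `i < |d|` ⇒ `p(x) ≤ M`. [cite: Garloff1986, §2] -/
theorem eval_le_of_bernRep {p : Poly} {d : List ℕ} {lo hi : ℕ → ℚ} {b : List ℚ} (h : bernRep p d lo hi b = true)
    {M : ℚ} (hM : ∀ c ∈ b, c ≤ M) {x : ℕ → K}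
    (hx : ∀ i, i < d.length → (lo i : K) ≤ x i ∧ x i ≤ (hi i : K)) :
    Poly.eval x p ≤ (M : K) := by
  rw [eval_eq_bernForm_of_bernRep h x]
  simp only [bernRep, Bool.and_eq_true, decide_eq_true_eq] at h
  refine eval_bernForm_le d 0 b ?_ ?_ ?_
  · intro i hi; simpa using bernWidths_sound d.length 0 h.1.1 i hi
  · intro i hi; simpa using hx i hi
  · intro i hi; exact hM _ (getD_mem (lt_of_lt_of_le hi h.1.2))

/-- **Range enclosure from below, by a checked representation**: `bernRep p d lo hi b`, every listed coefficient `≥ m`, and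
`lo_i ≤ x_i ≤ hi_i` for `i < |d|` ⇒ `m ≤ p(x)`. [cite: Garloff1986, §2] -/
theorem le_eval_of_bernRep {p : Poly} {d : List ℕ} {lo hi : ℕ → ℚ} {b : List ℚ} (h : bernRep p d lo hi b = true)
    {m : ℚ} (hm : ∀ c ∈ b, m ≤ c) {x : ℕ → K}
    (hx : ∀ i, i < d.length → (lo i : K) ≤ x i ∧ x i ≤ (hi i : K)) :
    (m : K) ≤ Poly.eval x p := by
  rw [eval_eq_bernForm_of_bernRep h x]
  simp only [bernRep, Bool.and_eq_true, decide_eq_true_eq] at h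
  refine le_eval_bernForm d 0 b ?_ ?_ ?_
  · intro i hi; simpa using bernWidths_sound d.length 0 h.1.1 i hi
  · intro i hi; simpa using hx i hi
  · intro i hi; exact hm _ (getD_mem (lt_of_lt_of_le hi h.1.2))

/-- **Upper range test, soundness** (the one a «BALL» rider decides): `bernUpper p d lo hi b M = true` and `lo_i ≤ x_i ≤ hi_i` for
`i < |d|` ⇒ `p(x) ≤ M`. [cite: Garloff1986, §2] -/
theorem eval_le_of_bernUpper {p : Poly} {d : List ℕ} {lo hi : ℕ → ℚ} {b : List ℚ} {M : ℚ}
    (h : bernUpper p d lo hi b M = true) {x : ℕ → K}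
    (hx : ∀ i, i < d.length → (lo i : K) ≤ x i ∧ x i ≤ (hi i : K)) :
    Poly.eval x p ≤ (M : K) := by
  simp only [bernUpper, Bool.and_eq_true, List.all_eq_true, decide_eq_true_eq] at h
  exact eval_le_of_bernRep h.1 h.2 hx

/-- **Lower range test, soundness**: `bernLower p d lo hi b m = true` and `lo_i ≤ x_i ≤ hi_i` for `i < |d|` ⇒ `m ≤ p(x)`
(a box-positivity certificate when `0 < m`). [cite: Garloff1986, §2] -/
theorem le_eval_of_bernLower {p : Poly} {d : List ℕ} {lo hi : ℕ → ℚ} {b : List ℚ} {m : ℚ}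
    (h : bernLower p d lo hi b m = true) {x : ℕ → K}
    (hx : ∀ i, i < d.length → (lo i : K) ≤ x i ∧ x i ≤ (hi i : K)) :
    (m : K) ≤ Poly.eval x p := by
  simp only [bernLower, Bool.and_eq_true, List.all_eq_true, decide_eq_true_eq] at h
  exact le_eval_of_bernRep h.1 h.2 hx

end Eval

/-! ### Kernel tests -/

/-- Test (kernel, one variable): `x₀²` on `[−1, 2]` has degree-2 Bernstein coefficients `[1, −2, 4]`
(`x₀ = −1 + 3t`: `x₀² = 1·B₀ − 2·B₁ + 4·B₂`), hence `−2 ≤ x₀² ≤ 4` there. -/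
example : bernUpper [(([2] : List ℕ), (1 : ℚ))] [2] (vars [(-1 : ℚ)]) (vars [(2 : ℚ)]) [1, -2, 4] 4 = true := by
  decide +kernel

/-- Test (kernel, two variables): `x₀ x₁ − x₁²` on `[0, 1] × [0, 2]` with degrees `(1, 2)` has coefficients
`[0, 0, −4, 0, 1, −2]` (blocks `j₀ = 0`: `[0, 0, −4]`, `j₀ = 1`: `[0, 1, −2]`), hence `−4 ≤ p ≤ 1` there. -/
example : bernLower [(([1, 1] : List ℕ), (1 : ℚ)), (([0, 2] : List ℕ), (-1 : ℚ))] [1, 2]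
    (vars [(0 : ℚ), 0]) (vars [(1 : ℚ), 2]) [0, 0, -4, 0, 1, -2] (-4) = true := by
  decide +kernel

/-- Test (kernel): a wrong coefficient list is REJECTED by the representation check. -/
example : bernRep [(([2] : List ℕ), (1 : ℚ))] [2] (vars [(-1 : ℚ)]) (vars [(2 : ℚ)]) [1, -2, 3] = false := by
  decide +kernel

end Summit.Ventures.GridStability.Lyapunov.PolyRecast
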